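import Literature.Probability.RandomPlanarGeometry.SLEKappaRhoDriftGlue
import Literature.Probability.RandomPlanarGeometry.LoewnerImageStepFar
import HarnessLib

/-!
# [LSW] Lemma 8.9, one step of the flow: the jets of the slid hull at `(0, O')` versus those of the hull at `(x_h, O)`

G. F. Lawler, O. Schramm, W. Werner, *Conformal restriction: the chordal case*, J. Amer. Math.
Soc. **16** (2003) 917–955 (**[LSW]**), §8.4, proof of Lemma 8.9: the differentials
`d[h_t(W_t)], d[h_t'(W_t)], d[h_t(O_t)], d[h_t'(O_t)]` (with [LSW] (5.1) for the `dt`-parts).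

One step of the Loewner flow (increment driver `U` on `[0, u]`, `x_h = U_u`, slid hull
`B' = slidHull U B u`, `E = E_B = starMap B`, `E' = starMap B'`, the step `st = starStep B U u`
of `StarHullCanonical`): the three arguments of the logarithms in `ell` for the NEW hull at the
NEW points `(0, y − x_h)` (`y` = old position of `O` plus its displacement) are those of the OLD
hull at `(x_h, y)` plus the perturbations

  `s₁ = st'(x_h)`,  `s₂ = st'(y)`,  `s₃ = DQ st x_h y`          (`starMap_slidHull_eq` and its jets),

and each `sᵢ` is `2u` times the corresponding quantity of the drift function
`D = glueDrift B ρ₀` up to `O(u(η_s + u))` (`η_s = stepSize S u`):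

* `norm_e₁_le` — `|st'(x_h) − 2u D'(x_h)| ≤ 200000 u (η_s ρ₀ + u)/(d ρ₀⁴)` (near the tip,
  `Loewner.norm_deriv_starStep_sub_drift_le`);
* `norm_e₂_le` — the same at the force point `y ≤ 0` (near the tip if `|y| ≤ ρ₀/8`, else
  `LoewnerImageStepFar.norm_deriv_hmapT_sub_hmap_sub_far_le` with `|E| ≥ δρ₀/16`);
* `norm_e₃_le` — `|DQ st x_h y − 2u DQ D x_h y| ≤ …` (the divided difference of the holomorphic
  remainder `st − 2uD`: Lipschitz near the tip by the Cauchy estimate, pointwise far from it).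

All bounds are `u · (A η_s + A' u)` with constants explicit in `d = starDeriv B`, `δ`, `η`, `ρ₀`
(`stepErr₁`, `stepErr₂`, `stepErr₃`). No named facts.

## References

* [LSW] §8.4 proof of Lemma 8.9; §5 (5.1). [LawlerSchrammWerner2003Restriction]
* G. F. Lawler, *Conformally Invariant Processes in the Plane* (2005), Prop. 4.40. [Lawler2005]
-/

noncomputable section

open Set Filter Metric Complex
open scoped Topology Real NNReal
open UpperHalfPlane (upperHalfPlaneSet)

namespace Literature.Probability.RandomPlanarGeometry

namespace SLEKappaRho

open Loewner Literature.Analysis.Complex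

variable {B : Set ℂ} {ρ₀ δ η R : ℝ} {U : ℝ≥0 → ℝ} {u : ℝ≥0} {S : ℝ}

/-! ### The reflected map of the slid hull through the step -/

/-- **`E_{B'}(w) = st(w + x_h) − st(x_h) + E_B(w + x_h) − E_B(x_h)`** (`x_h = U_u`): the definition of
`starStep` and `E_{B'}(0) = 0`. [cite: LawlerSchrammWerner2003Restriction, §5 (h_t = g_{A_t}, A_t = g_t(A))] -/
theorem starMap_slidHull_eq (hB' : IsStarHull (slidHull U B u)) (w : ℂ) :
    starMap (slidHull U B u) w =
      starStep B U u (w + U u) - starStep B U u (U u) + (starMap B (w + U u) - starMap B (U u)) := by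
  have h0 := starMap_zero hB'
  simp only [starStep, add_sub_cancel_right, sub_self]
  rw [h0]
  ring

/-- The derivative of `E_{B'}` at `w` is `st'(w + x_h) + E_B'(w + x_h)` whenever `st` and `E_B` are
differentiable at `w + x_h`. [folklore] -/
theorem hasDerivAt_starMap_slidHull (hB' : IsStarHull (slidHull U B u)) {w s' e' : ℂ}
    (hst : HasDerivAt (starStep B U u) s' (w + U u)) (hE : HasDerivAt (starMap B) e' (w + U u)) :
    HasDerivAt (starMap (slidHull U B u)) (s' + e') w := by
  have hfun : starMap (slidHull U B u) = fun w ↦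
      starStep B U u (w + U u) - starStep B U u (U u) + (starMap B (w + U u) - starMap B (U u)) :=
    funext (starMap_slidHull_eq hB')
  rw [hfun]
  have h1 : HasDerivAt (fun w : ℂ ↦ starStep B U u (w + U u)) s' w := hst.comp_add_const w (U u : ℂ)
  have h2 : HasDerivAt (fun w : ℂ ↦ starMap B (w + U u)) e' w := hE.comp_add_const w (U u : ℂ)
  exact (h1.sub_const _).add (h2.sub_const _)

/-- `st` is differentiable at `z` with derivative `E_{B'}'(z − x_h) − E_B'(z)` when `E_{B'}` is
differentiable at `z − x_h` and `E_B` at `z`. [folklore] -/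
theorem hasDerivAt_starStep {z a' b' : ℂ} (ha : HasDerivAt (starMap (slidHull U B u)) a' (z - U u))
    (hb : HasDerivAt (starMap B) b' z) : HasDerivAt (starStep B U u) (a' - b') z := by
  have h1 : HasDerivAt (fun y : ℂ ↦ starMap (slidHull U B u) (y - U u)) a' z := by
    simpa using ha.comp_sub_const z (U u : ℂ)
  have hfun : starStep B U u = fun y ↦ (starMap (slidHull U B u) (y - U u) - starShift (slidHull U B u) + U u) -
      (starMap B y - starShift B) := rfl
  rw [hfun]
  exact ((h1.sub_const _).add_const _).sub (hb.sub_const _)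

/-- `DQ` is additive: `DQ (f + g) = DQ f + DQ g` pointwise (on the diagonal: when both are
differentiable there). [folklore] -/
theorem DQ_add_of {f g : ℂ → ℂ} {x y : ℂ} (h : x = y → DifferentiableAt ℂ f y ∧ DifferentiableAt ℂ g y) :
    DQ (fun w ↦ f w + g w) x y = DQ f x y + DQ g x y := by
  rcases eq_or_ne x y with rfl | hne
  · obtain ⟨hf, hg⟩ := h rfl
    rw [DQ_same, DQ_same, DQ_same]
    exact deriv_add hf hg
  · rw [DQ_of_ne _ hne, DQ_of_ne _ hne, DQ_of_ne _ hne]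
    field_simp [sub_ne_zero.2 hne]
    ring

/-! ### The setting of one step, and the three errors -/

section Step

variable (hB : IsStarHull B) (hρ₀ : 0 < ρ₀) (hBρ : Disjoint (ball (0 : ℂ) (8 * ρ₀)) B)
  (hJ : JetControl (starMap B) δ η R)
  (hU : Continuous U) (hU0 : U 0 = 0) (hu : 0 < u) (hS : ∀ v : ℝ≥0, v ≤ u → |U v| ≤ S)
  (hηs : stepSize S u ≤ starDeriv B * ρ₀ / 1000)

include hB hρ₀ hBρ hU hU0 hu hS hηs in
/-- `st` is holomorphic on `ball 0 (ρ₀/2)` with derivative `E_{B'}'(z − x_h) − E_B'(z)`. [folklore] -/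
theorem hasDerivAt_starStep_near {z : ℂ} (hz : z ∈ ball (0 : ℂ) (ρ₀ / 2)) :
    HasDerivAt (starStep B U u) (deriv (starMap (slidHull U B u)) (z - U u) - deriv (starMap B) z) z := by
  obtain ⟨hUu, hη1, hη0⟩ := abs_driver_le hB hu hS hρ₀ hηs
  have hA := (Loewner.differentiableOn_starMap hB hρ₀ hBρ).analyticOnNhd isOpen_ball
  have hA' := (differentiableOn_starMap_slidHull hB hU hU0 hu hS hρ₀ hBρ hηs).analyticOnNhd isOpen_ball
  rw [mem_ball_zero_iff] at hz
  have hz4 : z ∈ ball (0 : ℂ) (4 * ρ₀) := mem_ball_zero_iff.2 (by linarith)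
  have hz6 : z - U u ∈ ball (0 : ℂ) (6 * ρ₀) := by
    rw [mem_ball_zero_iff]
    calc ‖z - U u‖ ≤ ‖z‖ + ‖((U u : ℝ) : ℂ)‖ := norm_sub_le _ _
      _ < 6 * ρ₀ := by rw [norm_real, Real.norm_eq_abs]; linarith
  exact hasDerivAt_starStep ((hA' _ hz6).differentiableAt.hasDerivAt) ((hA _ hz4).differentiableAt.hasDerivAt)

include hB hρ₀ hBρ hU hU0 hu hS hηs in
/-- `st − 2u·starDrift` is holomorphic on `ball 0 (ρ₀/2)`. [folklore] -/
theorem differentiableOn_stepRem_near :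
    DifferentiableOn ℂ (fun w ↦ starStep B U u w - 2 * (u : ℂ) * starDrift B ρ₀ w) (ball (0 : ℂ) (ρ₀ / 2)) := by
  have hDd := Loewner.differentiableOn_starDrift hB hρ₀ hBρ
  intro w hw
  exact ((hasDerivAt_starStep_near hB hρ₀ hBρ hU hU0 hu hS hηs hw).differentiableAt.sub
    ((hDd.differentiableAt (isOpen_ball.mem_nhds hw)).const_mul _)).differentiableWithinAt

/-- The `η_s`/`u` coefficients of the near errors: `st'(z) − 2uD'(z)` (`|z| ≤ ρ₀/8`). [folklore] -/
def stepErr₁ (d ρ₀ : ℝ) (ηs u : ℝ) : ℝ := 200000 * u * (ηs * ρ₀ + u) / (d * ρ₀ ^ 4)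

include hB hρ₀ hBρ hU hU0 hu hS hηs in
/-- **`e₁`: `|st'(x_h) − 2u D'(x_h)| ≤ stepErr₁`** at the tip side (`|x_h| ≤ η_s ≤ ρ₀/8`; `D = glueDrift`
agrees with `starDrift` there). [cite: LawlerSchrammWerner2003Restriction, proof of Lemma 8.9 (d[h'(W_t)])] -/
theorem norm_e₁_le {z : ℂ} (hz : ‖z‖ ≤ ρ₀ / 8) :
    ‖(deriv (starMap (slidHull U B u)) (z - U u) - deriv (starMap B) z) - 2 * (u : ℂ) * deriv (glueDrift B ρ₀) z‖ ≤
      stepErr₁ (starDeriv B) ρ₀ (stepSize S u) u := by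
  have hev := glueDrift_eventuallyEq_starDrift (B := B) (ρ₀ := ρ₀) (z := z) (by linarith)
  rw [hev.deriv_eq]
  exact norm_deriv_starStep_sub_drift_le hB hU hU0 hu hS hρ₀ hBρ hηs hz

include hB hρ₀ hBρ hU hU0 hu hS hηs in
/-- **The near remainder is Lipschitz on `ball 0 (ρ₀/8)`**: for `z, w` there,
`|(st − 2uD)(z) − (st − 2uD)(w)| ≤ (16 · 25000 u(η_sρ₀ + u)/(dρ₀³) / ρ₀)|z − w|` (Cauchy from the sup
bound `Loewner.norm_starStep_sub_drift_le` on `ball 0 (ρ₀/4)`). [folklore] -/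
theorem norm_stepRem_sub_le_near {z w : ℂ} (hz : z ∈ ball (0 : ℂ) (ρ₀ / 8)) (hw : w ∈ ball (0 : ℂ) (ρ₀ / 8)) :
    ‖(starStep B U u z - 2 * (u : ℂ) * glueDrift B ρ₀ z) - (starStep B U u w - 2 * (u : ℂ) * glueDrift B ρ₀ w)‖ ≤
      4 * (25000 * u * (stepSize S u * ρ₀ + u) / (starDeriv B * ρ₀ ^ 3)) / (ρ₀ / 4) * ‖z - w‖ := by
  have hz4 : ‖z‖ < ρ₀ / 4 := by rw [mem_ball_zero_iff] at hz; linarith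
  have hw4 : ‖w‖ < ρ₀ / 4 := by rw [mem_ball_zero_iff] at hw; linarith
  rw [glueDrift_eq_starDrift hz4, glueDrift_eq_starDrift hw4]
  have hD := (differentiableOn_stepRem_near hB hρ₀ hBρ hU hU0 hu hS hηs).mono (ball_subset_ball (by linarith) :
    ball (0 : ℂ) (ρ₀ / 4) ⊆ ball (0 : ℂ) (ρ₀ / 2))
  have hM : ∀ y ∈ ball (0 : ℂ) (ρ₀ / 4), ‖starStep B U u y - 2 * (u : ℂ) * starDrift B ρ₀ y‖ ≤
      25000 * u * (stepSize S u * ρ₀ + u) / (starDeriv B * ρ₀ ^ 3) := fun y hy ↦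
    norm_starStep_sub_drift_le hB hU hU0 hu hS hρ₀ hBρ hηs (mem_ball_zero_iff.1 hy).le
  exact norm_sub_le_mul_of_forall_mem_ball (by positivity) hD hM
    (by simpa [show ρ₀ / 4 / 2 = ρ₀ / 8 by ring] using hz) (by simpa [show ρ₀ / 4 / 2 = ρ₀ / 8 by ring] using hw)

include hB hρ₀ hBρ hJ hU hU0 hu hS hηs in
/-- **`e₂` far from the tip**: for a real `y ∈ [−R−2, 0]` with `|y| ≥ ρ₀/8`, `B(y, ρ₀) ∩ B = ∅`,
`0 < r₁ ≤ ρ₀/48`, `3r₁ < η` and `8η_s ≤ δρ₀/16`,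
`|E_{B'}'(y − x_h) − E_B'(y) − 2u D'(y)| ≤ 2u(farC₁ η_s + farC₂ u)/r₁` with `m₀ = δρ₀/16`
(`LoewnerImageStepFar`, the lower bound `|E_B| ≥ δ|z| ≥ δρ₀/16` on `ball y (3r₁) ⊆ jetBox`).
[cite: LawlerSchrammWerner2003Restriction, proof of Lemma 8.9 (d[h'(O_t)]) with §5 (5.1)] -/
theorem norm_e₂_far_le {y : ℝ} (hy : y ∈ Icc (-R - 2) 0) (hyfar : ρ₀ / 8 ≤ |y|)
    (hBy : Disjoint (ball (y : ℂ) ρ₀) B) {r₁ : ℝ} (hr₁ : 0 < r₁) (hr₁' : r₁ ≤ ρ₀ / 48) (hr₁η : 3 * r₁ < η)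
    (hm : 8 * stepSize S u ≤ δ * ρ₀ / 16) :
    ‖(deriv (starMap (slidHull U B u)) (y - U u) - deriv (starMap B) y) - 2 * (u : ℂ) * deriv (glueDrift B ρ₀) y‖ ≤
      2 * (u * (farC₁ (starDeriv B) ρ₀ (δ * ρ₀ / 16) * stepSize S u +
        farC₂ (starDeriv B) ρ₀ (δ * ρ₀ / 16) r₁ * u)) / r₁ := by
  obtain ⟨hη1s, hB'⟩ := isStarHull_slidHull_canonical hB hU hU0 hS hρ₀ hBρ hηs
  have hd := (starDeriv_spec hB).2.2
  have hΦ := isRestrictionMap_starRMap hB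
  have hΦ' := isRestrictionMap_starRMap hB'
  have hy0 : (y : ℂ) ≠ 0 := by
    intro h; have : y = 0 := by exact_mod_cast h
    rw [this, abs_zero] at hyfar; linarith
  have hyB : (y : ℂ) ∈ jetBox R η := ofReal_mem_jetBox hJ ⟨hy.1, hy.2.trans hJ.η_pos.le⟩
  -- the lower bound on `ball y (3 r₁)`
  have hm₀ : ∀ z ∈ ball (y : ℂ) (3 * r₁), δ * ρ₀ / 16 ≤ ‖hullExt (starRMap B hB) z‖ := by
    intro z hz
    have hzB : z ∈ jetBox R η :=
      ball_subset_jetBox hJ.η_le_one ⟨hy.1, hy.2.trans hJ.η_pos.le⟩ (ball_subset_ball hr₁η.le hz)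
    have hzn : ρ₀ / 16 ≤ ‖z‖ := by
      rw [mem_ball, dist_eq_norm] at hz
      have h1 : ‖(y : ℂ)‖ = |y| := by rw [norm_real, Real.norm_eq_abs]
      have := norm_sub_norm_le (y : ℂ) z
      rw [h1, norm_sub_rev] at this
      linarith
    rw [← starMap_eq hB]
    calc δ * ρ₀ / 16 = δ * (ρ₀ / 16) := by ring
      _ ≤ δ * ‖z‖ := by gcongr; exact hJ.δ_pos.le
      _ ≤ ‖starMap B z‖ := norm_starMap_ge hJ hzB
  have h := norm_deriv_hmapT_sub_hmap_sub_far_le hB hΦ hd hU hU0 hu hS hρ₀ hBρ hηs hΦ' hr₁ hr₁' hyfar hBy hm₀ hm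
  rw [← starMap_eq hB, ← starMap_eq hB'] at h
  -- identify the derivative of the formula with that of `glueDrift`
  have hform := (hasDerivAt_driftFormula hJ hyB hy0).deriv
  obtain ⟨-, hD'⟩ := glueDrift_and_deriv_of_ne_zero hB hρ₀ hBρ hJ hyB hy0
  have heq : deriv (fun z ↦ (starDeriv B : ℂ) ^ 2 / starMap B z - deriv (starMap B) z / z) y = deriv (glueDrift B ρ₀) y := by
    rw [hform, hD']; field_simp; ring
  rwa [heq] at h

include hB hρ₀ hBρ hJ hU hU0 hu hS hηs in
/-- **The far value of the remainder**: `|(st − 2uD)(y)| ≤ u(farC₁ η_s + farC₂ u)` at such a `y`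
(`LoewnerImageStepFar.norm_hmapT_sub_hmap_sub_far_le` at the centre). [cite: LawlerSchrammWerner2003Restriction, §5 (5.1)] -/
theorem norm_stepRem_far_le {y : ℝ} (hy : y ∈ Icc (-R - 2) 0) (hyfar : ρ₀ / 8 ≤ |y|)
    (hBy : Disjoint (ball (y : ℂ) ρ₀) B) {r₁ : ℝ} (hr₁ : 0 < r₁) (hr₁' : r₁ ≤ ρ₀ / 48) (hr₁η : 3 * r₁ < η)
    (hm : 8 * stepSize S u ≤ δ * ρ₀ / 16) :
    ‖starStep B U u y - 2 * (u : ℂ) * glueDrift B ρ₀ y‖ ≤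
      u * (farC₁ (starDeriv B) ρ₀ (δ * ρ₀ / 16) * stepSize S u + farC₂ (starDeriv B) ρ₀ (δ * ρ₀ / 16) r₁ * u) := by
  obtain ⟨hη1s, hB'⟩ := isStarHull_slidHull_canonical hB hU hU0 hS hρ₀ hBρ hηs
  have hd := (starDeriv_spec hB).2.2
  have hΦ := isRestrictionMap_starRMap hB
  have hΦ' := isRestrictionMap_starRMap hB'
  have hy0 : (y : ℂ) ≠ 0 := by
    intro h; have : y = 0 := by exact_mod_cast h
    rw [this, abs_zero] at hyfar; linarith
  have hm₀ : ∀ z ∈ ball (y : ℂ) (3 * r₁), δ * ρ₀ / 16 ≤ ‖hullExt (starRMap B hB) z‖ := by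
    intro z hz
    have hzB : z ∈ jetBox R η :=
      ball_subset_jetBox hJ.η_le_one ⟨hy.1, hy.2.trans hJ.η_pos.le⟩ (ball_subset_ball hr₁η.le hz)
    have hzn : ρ₀ / 16 ≤ ‖z‖ := by
      rw [mem_ball, dist_eq_norm] at hz
      have h1 : ‖(y : ℂ)‖ = |y| := by rw [norm_real, Real.norm_eq_abs]
      have := norm_sub_norm_le (y : ℂ) z
      rw [h1, norm_sub_rev] at this
      linarith
    rw [← starMap_eq hB]
    calc δ * ρ₀ / 16 = δ * (ρ₀ / 16) := by ring
      _ ≤ δ * ‖z‖ := by gcongr; exact hJ.δ_pos.le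
      _ ≤ ‖starMap B z‖ := norm_starMap_ge hJ hzB
  have h := norm_hmapT_sub_hmap_sub_far_le hB hΦ hd hU hU0 hu hS hρ₀ hBρ hηs hΦ' hr₁ hr₁' hyfar hBy hm₀ hm
    (ζ := (y : ℂ)) (mem_closedBall_self hr₁.le)
  rw [hmapT_starRMap hB', hmap_starRMap hB, ← starMap_eq hB, ← glueDrift_eq_of_ne_zero hB hρ₀ hBρ hy0] at h
  have hst : starStep B U u y = starMap (slidHull U B u) ((y : ℂ) - U u) - starShift (slidHull U B u) + U u -
      (starMap B y - starShift B) := rfl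
  rw [hst]
  exact h

/-- `DQ` of `f − c·g` is `DQ f − c·DQ g` (on the diagonal: when both are differentiable there).
[folklore] -/
theorem DQ_sub_const_mul_of {f g : ℂ → ℂ} {c x y : ℂ}
    (h : x = y → DifferentiableAt ℂ f y ∧ DifferentiableAt ℂ g y) :
    DQ (fun w ↦ f w - c * g w) x y = DQ f x y - c * DQ g x y := by
  rcases eq_or_ne x y with rfl | hne
  · obtain ⟨hf, hg⟩ := h rfl
    rw [DQ_same, DQ_same, DQ_same, deriv_fun_sub hf (hg.const_mul c), deriv_const_mul c hg]
  · rw [DQ_of_ne _ hne, DQ_of_ne _ hne, DQ_of_ne _ hne]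
    field_simp [sub_ne_zero.2 hne]
    ring

include hB hρ₀ hBρ hU hU0 hu hS hηs in
/-- **`e₃` near the tip**: for `x, y ∈ ball 0 (ρ₀/8)`,
`|DQ st x y − 2u DQ D x y| ≤ 3 · stepErr₁` (off the diagonal the Lipschitz bound of the remainder
`st − 2uD`, `= 2 stepErr₁`; on the diagonal its derivative, `≤ stepErr₁`).
[cite: LawlerSchrammWerner2003Restriction, proof of Lemma 8.9 (d[h(W) − h(O)])] -/
theorem norm_e₃_near_le {x y : ℂ} (hx : x ∈ ball (0 : ℂ) (ρ₀ / 8)) (hy : y ∈ ball (0 : ℂ) (ρ₀ / 8)) :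
    ‖DQ (starStep B U u) x y - 2 * (u : ℂ) * DQ (glueDrift B ρ₀) x y‖ ≤
      3 * stepErr₁ (starDeriv B) ρ₀ (stepSize S u) u := by
  obtain ⟨hd0, -, -⟩ := starDeriv_spec hB
  obtain ⟨hUu, hη1, hη0⟩ := abs_driver_le hB hu hS hρ₀ hηs
  have hx2 : x ∈ ball (0 : ℂ) (ρ₀ / 2) := ball_subset_ball (by linarith) hx
  have hy2 : y ∈ ball (0 : ℂ) (ρ₀ / 2) := ball_subset_ball (by linarith) hy
  have hy4 : ‖y‖ < ρ₀ / 4 := by rw [mem_ball_zero_iff] at hy; linarith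
  have hDd := Loewner.differentiableOn_starDrift hB hρ₀ hBρ
  -- rewrite as the divided difference of the remainder
  have hdiag : x = y → DifferentiableAt ℂ (starStep B U u) y ∧ DifferentiableAt ℂ (glueDrift B ρ₀) y := fun _ ↦
    ⟨(hasDerivAt_starStep_near hB hρ₀ hBρ hU hU0 hu hS hηs hy2).differentiableAt,
      ((hDd.differentiableAt (isOpen_ball.mem_nhds hy2)).congr_of_eventuallyEq
        (glueDrift_eventuallyEq_starDrift hy4))⟩
  rw [← DQ_sub_const_mul_of hdiag]
  have hE1 : 0 ≤ stepErr₁ (starDeriv B) ρ₀ (stepSize S u) u := by unfold stepErr₁; positivity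
  rcases eq_or_ne x y with rfl | hne
  · -- on the diagonal: the derivative of the remainder
    rw [DQ_same]
    have hder : HasDerivAt (fun w ↦ starStep B U u w - 2 * (u : ℂ) * glueDrift B ρ₀ w)
        ((deriv (starMap (slidHull U B u)) (x - U u) - deriv (starMap B) x) - 2 * (u : ℂ) * deriv (glueDrift B ρ₀) x) x := by
      have h1 := hasDerivAt_starStep_near hB hρ₀ hBρ hU hU0 hu hS hηs hx2
      have h2 : HasDerivAt (glueDrift B ρ₀) (deriv (glueDrift B ρ₀) x) x := (hdiag rfl).2.hasDerivAt
      exact h1.sub (h2.const_mul _)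
    rw [hder.deriv]
    have := norm_e₁_le hB hρ₀ hBρ hU hU0 hu hS hηs (z := x) (mem_ball_zero_iff.1 hx).le
    linarith
  · rw [DQ_of_ne _ hne, norm_div]
    have hL := norm_stepRem_sub_le_near hB hρ₀ hBρ hU hU0 hu hS hηs hx hy
    rw [div_le_iff₀ (norm_pos_iff.2 (sub_ne_zero.2 hne))]
    refine hL.trans ?_
    have hnn : 0 ≤ ‖x - y‖ := norm_nonneg _
    have heq : 4 * (25000 * u * (stepSize S u * ρ₀ + u) / (starDeriv B * ρ₀ ^ 3)) / (ρ₀ / 4) =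
        2 * stepErr₁ (starDeriv B) ρ₀ (stepSize S u) u := by
      unfold stepErr₁; field_simp; ring
    rw [heq]
    nlinarith

include hB hρ₀ hBρ hJ hU hU0 hu hS hηs in
/-- **`e₃` far from the tip**: for `|x| ≤ η_s` and a real `y ∈ [−R−2, 0]` with `|y| ≥ ρ₀/8` (and the
far data of `norm_e₂_far_le`), `|DQ st x y − 2u DQ D x y| ≤ 9 (25000u(η_sρ₀ + u)/(dρ₀³) + u(farC₁η_s + farC₂u))/ρ₀`
(the two values of the remainder, divided by `|x − y| ≥ ρ₀/9`).
[cite: LawlerSchrammWerner2003Restriction, proof of Lemma 8.9 (d[h(W) − h(O)])] -/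
theorem norm_e₃_far_le {x : ℂ} (hx : ‖x‖ ≤ stepSize S u) {y : ℝ} (hy : y ∈ Icc (-R - 2) 0) (hyfar : ρ₀ / 8 ≤ |y|)
    (hBy : Disjoint (ball (y : ℂ) ρ₀) B) {r₁ : ℝ} (hr₁ : 0 < r₁) (hr₁' : r₁ ≤ ρ₀ / 48) (hr₁η : 3 * r₁ < η)
    (hm : 8 * stepSize S u ≤ δ * ρ₀ / 16) :
    ‖DQ (starStep B U u) x y - 2 * (u : ℂ) * DQ (glueDrift B ρ₀) x y‖ ≤
      9 * (25000 * u * (stepSize S u * ρ₀ + u) / (starDeriv B * ρ₀ ^ 3) +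
        u * (farC₁ (starDeriv B) ρ₀ (δ * ρ₀ / 16) * stepSize S u + farC₂ (starDeriv B) ρ₀ (δ * ρ₀ / 16) r₁ * u)) / ρ₀ := by
  obtain ⟨hUu, hη1, hη0⟩ := abs_driver_le hB hu hS hρ₀ hηs
  have hyn : ‖(y : ℂ)‖ = |y| := by rw [norm_real, Real.norm_eq_abs]
  have hne : x ≠ (y : ℂ) := by
    intro h; rw [h, hyn] at hx; linarith
  have hdist : ρ₀ / 9 ≤ ‖x - y‖ := by
    have := norm_sub_norm_le (y : ℂ) x
    rw [hyn, norm_sub_rev] at this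
    linarith
  rw [← DQ_sub_const_mul_of (fun h ↦ absurd h hne), DQ_of_ne _ hne, norm_div]
  have hFx : ‖starStep B U u x - 2 * (u : ℂ) * glueDrift B ρ₀ x‖ ≤
      25000 * u * (stepSize S u * ρ₀ + u) / (starDeriv B * ρ₀ ^ 3) := by
    rw [glueDrift_eq_starDrift (by linarith : ‖x‖ < ρ₀ / 4)]
    exact norm_starStep_sub_drift_le hB hU hU0 hu hS hρ₀ hBρ hηs (by linarith)
  have hFy := norm_stepRem_far_le hB hρ₀ hBρ hJ hU hU0 hu hS hηs hy hyfar hBy hr₁ hr₁' hr₁η hm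
  rw [div_le_iff₀ (lt_of_lt_of_le (by positivity) hdist)]
  have hsum := (norm_sub_le _ _).trans (add_le_add hFx hFy)
  set T := 25000 * u * (stepSize S u * ρ₀ + u) / (starDeriv B * ρ₀ ^ 3) +
    u * (farC₁ (starDeriv B) ρ₀ (δ * ρ₀ / 16) * stepSize S u + farC₂ (starDeriv B) ρ₀ (δ * ρ₀ / 16) r₁ * u) with hT
  have hT0 : 0 ≤ T := (norm_nonneg _).trans hsum
  calc _ ≤ T := hsum
    _ = 9 * T / ρ₀ * (ρ₀ / 9) := by field_simp
    _ ≤ 9 * T / ρ₀ * ‖x - y‖ := by gcongr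

end Step

end SLEKappaRho

end Literature.Probability.RandomPlanarGeometry

end
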